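import Summits.CriticalPhenomena.Ising3DConformalLimit.Theorems.HyperoctahedralRPExistsScaleCovariantLimitFoldedCurrentSpectralEdgeTauberian
import Summits.CriticalPhenomena.Ising3DConformalLimit.Theorems.HyperoctahedralRPExistsScaleCovariantLimitFoldedCurrentSqrtDoublingDenominator
import Summits.CriticalPhenomena.Ising3DConformalLimit.Theorems.HyperoctahedralRPExistsScaleCovariantLimitFunnelDoublingIffAxisRate
import Summits.CriticalPhenomena.Ising3DConformalLimit.Theses.MirrorHoelderCompactness
import Literature.Probability.LatticeModels.AxisSpectralRepresentationProofs
import Literature.Probability.LatticeModels.CriticalAxisRatioRegularity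
import Literature.Probability.LatticeModels.CriticalTwoPointLower
import HarnessLib

/-!
# Item 6150 `TwoPointDoubling` ⟺ the spectral measure of `σ₀` is doubling at the top of the spectrum
# (crux `ExistsScaleCovariantLimit`, stmt-CriticalPhenomena-1981, line `folded-current-repulsion`, F2 record)

`g₀(n) = ⟨σ₀σ_{n e₀}⟩⁺_{β_c(3)} = criticalTwoPoint 3 (Pi.single 0 n)` is a Hausdorff moment sequence:
`g₀(n) = ∫_{[0,1]} λⁿ dν` (Aizenman–Duminil-Copin 2021 App. Prop. 8.6, PROVED in the tree:
`AizenmanDuminilCopin2021_prop_8_6_holds`, `.criticalAxis`). The strategist's spectral-side target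
(census s1, instance UnitLightCone, `Cruxes/ExistsScaleCovariantLimit/SketchS1ULC.lean`, stated there as the
`Prop` `SpectralEdgeDoublingIffTwoPointDoubling` "so that a prover can pick it up") is proved here
(registered sub-goal `spectralEdgeDoubling_iff_twoPointDoubling`, with the strategist's two definitions
unfolded so that no definition is introduced):

  (∀ representing `ν` on `[0,1]`, ∃ K y₀ > 0, ∀ y ∈ (0, y₀], ν[e^{-2y}, 1] ≤ K·ν[e^{-y}, 1])  ↔  `TwoPointDoubling`.

That is: ITEM 6150 (all-scale doubling of the axial critical two-point function, Aizenman–Duminil-Copin 2021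
Remark 5.10) IS EXACTLY the statement that the spectral measure of `σ₀` for the axial transfer matrix is a
DOUBLING MEASURE AT THE SPECTRAL EDGE `λ = 1` (gap variable `y = −log λ`). Both directions are the abstract
Tauberian pair `SpectralEdge.edgeDoubling_of_doubling` / `SpectralEdge.doubling_of_edgeDoubling` fed with the
tree's Ising facts: positivity (`criticalTwoPoint_axis_pos`), the one-step ratio bound `g₀(k+1) ≥ (g₀(2)/g₀(1)) g₀(k)`
(RP log-convexity, `criticalTwoPoint_axis_ratio_mono`), the Simon–Lieb envelope `c ≤ n² g₀(n)` (`axis_sq_level_ge`)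
and the existence of a representing measure.

Reading for the crux chains of items 1981 / 6150: a spectral-side proof of edge doubling for the `ℤ³`
transfer matrix at `β_c` would close item 6150 at once (`.1`); conversely every obstruction to 6150 is an
obstruction to edge doubling (`.2`) — e.g. the barrier witness of p149925 has a lacunary edge.

References: N. H. Bingham, C. M. Goldie, J. L. Teugels, *Regular Variation* (CUP 1987), §2.10
[BinghamGoldieTeugels1987]; L. de Haan, U. Stadtmüller, J. Math. Anal. Appl. 108 (1985) 344–365
[deHaanStadtmuller1985]; M. Aizenman, H. Duminil-Copin, Ann. of Math. 194 (2021), arXiv:1912.07973, App. Prop. 8.6,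
Remark 5.10 [AizenmanDuminilCopinAnnals2021].
-/

noncomputable section

open MeasureTheory Set Filter Real
open scoped Topology
open Literature.Probability.LatticeModels

namespace Summit.CriticalPhenomena.Ising3DConformalLimit.Cruxes.ExistsScaleCovariantLimit.FoldedCurrentRepulsion

/-- **The one-step ratio bound of the critical axis profile**: `(g₀(2)/g₀(1))·g₀(k) ≤ g₀(k+1)` for `k ≥ 1`
(RP log-convexity: the ratios `g₀(k+1)/g₀(k)` are non-decreasing). [cite: AizenmanDuminilCopinAnnals2021, arXiv:1912.07973 §5.5 proof of Prop. 5.9] -/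
theorem criticalAxis_ratio_lower : ∃ r : ℝ, 0 < r ∧ ∀ k : ℕ, 1 ≤ k →
    r * criticalTwoPoint 3 (Pi.single 0 (k : ℤ)) ≤ criticalTwoPoint 3 (Pi.single 0 ((k + 1 : ℕ) : ℤ)) := by
  have hpos : ∀ m : ℕ, 0 < criticalTwoPoint 3 (Pi.single 0 (m : ℤ)) := criticalTwoPoint_axis_pos
  refine ⟨criticalTwoPoint 3 (Pi.single 0 ((2 : ℕ) : ℤ)) / criticalTwoPoint 3 (Pi.single 0 ((1 : ℕ) : ℤ)),
    div_pos (hpos 2) (hpos 1), fun k hk => ?_⟩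
  have hmono := criticalTwoPoint_axis_ratio_mono 0 (Nat.zero_le (k - 1))
  simp only [zero_add, Nat.sub_add_cancel hk, show k - 1 + 2 = k + 1 by omega] at hmono
  rw [div_le_div_iff₀ (hpos 1) (hpos k)] at hmono
  rw [div_mul_eq_mul_div, div_le_iff₀ (hpos 1)]
  linarith

/-- **ITEM 6150 ⟺ DOUBLING OF THE SPECTRAL MEASURE AT THE EDGE** (registered sub-goal
`spectralEdgeDoubling_iff_twoPointDoubling` of item 1981; the strategist's `SpectralEdgeDoublingIffTwoPointDoubling`
with `SpectralEdgeDoubling` / `AxisHausdorffMoment` unfolded): every finite measure `ν` on `[0,1]` representing the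
critical axis profile (`g₀(n) = ∫ tⁿ dν`) is doubling at `λ = 1` — `ν[e^{-2y},1] ≤ K ν[e^{-y},1]` for small `y` —
if and only if `TwoPointDoubling` holds. [cite: BinghamGoldieTeugels1987, §2.10] [cite: deHaanStadtmuller1985, Thm 1]
[cite: AizenmanDuminilCopinAnnals2021, arXiv:1912.07973 Appendix Prop. 8.6 and Remark 5.10] -/
theorem spectralEdgeDoubling_iff_twoPointDoubling : (∀ μ : MeasureTheory.Measure ℝ, (MeasureTheory.IsFiniteMeasure μ ∧ μ (Set.Icc (0:ℝ) 1)ᶜ = 0 ∧ ∀ n : ℕ, Literature.Probability.LatticeModels.criticalTwoPoint 3 (Pi.single 0 (n : ℤ)) = ∫ t, t ^ n ∂μ) → ∃ K y₀ : ℝ, 0 < K ∧ 0 < y₀ ∧ ∀ y ∈ Set.Ioc (0:ℝ) y₀, μ.real (Set.Icc (Real.exp (-(2 * y))) 1) ≤ K * μ.real (Set.Icc (Real.exp (-y)) 1)) ↔ Summit.CriticalPhenomena.Ising3DConformalLimit.Theses.MirrorHoelderCompactness.TwoPointDoubling := by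
  have hpos : ∀ m : ℕ, 0 < criticalTwoPoint 3 (Pi.single 0 (m : ℤ)) := criticalTwoPoint_axis_pos
  have hratio := criticalAxis_ratio_lower
  constructor
  · -- Tauberian direction: take the representing measure of ADC21 Prop. 8.6
    intro h
    obtain ⟨ν, hfin, hsupp, hrep⟩ := AizenmanDuminilCopin2021_prop_8_6_holds.criticalAxis (d' := 2) (by norm_num)
      (spontaneousMagnetization_criticalBeta_eq_zero_holds (d := 2 + 1))
      (criticalBeta_pos_holds (d := 2 + 1)) 0
    obtain ⟨K, y₀, hK, hy₀, hdbl⟩ := h ν ⟨hfin, hsupp, hrep⟩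
    obtain ⟨κ, hκ, hd⟩ := SpectralEdge.doubling_of_edgeDoubling hfin hsupp hrep hpos hratio axis_sq_level_ge
      ⟨K, y₀, hK, hy₀, hdbl⟩
    refine ⟨κ, hκ, fun n hn => ?_⟩
    rw [Funnel.criticalTwoPoint_two_mul]
    exact hd n hn
  · -- Abelian direction: for every representing measure
    intro hD ν hν
    obtain ⟨hfin, hsupp, hrep⟩ := hν
    obtain ⟨κ, hκ, hd⟩ := hD
    have hd' : ∀ n : ℕ, 1 ≤ n → κ * criticalTwoPoint 3 (Pi.single 0 (n : ℤ)) ≤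
        criticalTwoPoint 3 (Pi.single 0 ((2 * n : ℕ) : ℤ)) := fun n hn => by
      rw [← Funnel.criticalTwoPoint_two_mul]; exact hd n hn
    exact SpectralEdge.edgeDoubling_of_doubling hfin hsupp hrep hpos hratio ⟨κ, hκ, hd'⟩

end Summit.CriticalPhenomena.Ising3DConformalLimit.Cruxes.ExistsScaleCovariantLimit.FoldedCurrentRepulsion

end
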